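import Summits.QuantumFields.BalabanUV.Beta.FP.SliceProjectorKernelLaplace

/-!
# `BalabanUV.Beta.FP.SliceProjectorDiffChord` — road «FP» (binder row D1), organisation γ, row GAMMA-3 «DIFFERENCE LETTERS OF `(1−Π)_N`» part 1∕3:
# THE CHORD AT AN ALIAS MOMENTUM `‖e^{±i(k_l)_μ} − 1‖ ≤ 33·j̃(l_μ)∕N` (distance to the NEAREST alias) AND THE WEIGHTED ALIAS SUMS
# `Σ_l j̃(l_μ)·‖qa_l‖‖e_l‖ ≤ Cqe(D)`, `Σ_l j̃(l_μ)·‖qb_l‖‖e_l‖ ≤ Cqe(D)` — n-UNIFORM WITH THE SAME CONSTANT AS GEN 8 (the extra residue weight costs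
# nothing: `j̃_μ·‖e_l‖·Π_i j̃_i^{1∕D} ≤ (1024∕7)·D` because `‖Δ^ξ(k+2πl)‖ ≥ (7∕64)·max_i j̃_i²`)

HONEST FRAMING (cell contract, verbatim): «discharging `BetaPertH` makes Bałaban's UV stability UNCONDITIONAL — a real constructive-QFT
result; it is NOT the continuum limit and NOT the Clay problem.»  HONEST DEPENDENCY (verbatim): «continuum YM on T⁴ ⇐ BetaPertH ∧ nine
spine estimates (0/9 proved); BetaPertH ⇐ (D1) ∧ (D4) ∧ CAP+tail; G-an2-4 gates asym, D1 and NE2/3/4.»  THIS MODULE DISCHARGES NOTHING of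
D1 ∕ BetaPertH: [folklore] one-variable trigonometric bookkeeping (`GAN24.AliasStripSymbols.norm_cexp_I_mul_sub_one_le'` ✓ BY NAME read modulo
`2π`) and gen-8's product-weight route (`SliceProjectorAliasIndex`∕`AliasSum` ✓ BY NAME: `jt`, `jt_sq_le_norm_DeltaXi_shift`, `norm_qa_le_prod`,
`wt`, `sum_prod_wt_eq`, `sum_wt_le`, `Cqe`) re-run with ONE extra factor `j̃(l_μ)`; no `def`, no `def … : Prop`; nothing is cited; 0 sorry.  NO NEW ENGINE
(R-FP-33 (c)): the same summable weight closes the sum — hence NO `log N` at first order.  NOT summit progress; NOT hbook, NOT D1, NOT BetaPertH,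
NOT continuum, NOT Clay.

ABSOLUTE RULE (cell, verbatim): «No internally-minted statement may enter as a cited fact. Every hypothesis is either kernel-proved in this
package or a verbatim quotation of a PUBLISHED theorem with page reference. The manuscript(s) under audit are NOT citable for their own
disputed steps — they are the thing under adjudication; programme-internal (2001/route/tribunal) claims are never citable.»

CONTENT (`D = d+1`, `n ≥ 1`; «fat strip» `Fat D (rOf D)` ⊇ `Strip D κ_Y` ⊇ the real zone):
* §1 `norm_cexp_I_mul_sub_one_le_shift` (`‖e^{iw} − 1‖ ≤ (|Re w − 2πm| + |Im w|)·e^{|Im w|}`, every `m ∈ ℤ`), `aliasPt_re`,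
  **`norm_cexp_aliasPt_sub_one_le`** (`‖e^{i s (k_l)_μ} − 1‖ ≤ 33·j̃(l_μ)∕n`, `s = ±1`: the alias momentum is within `10·j̃∕n` of `2πℤ` in real part
  — nearest alias `m = 0` if `j̃ = j+1`, `m = 1` if `j̃ = n−j` — and within `1∕n` in imaginary part, `e^{|Im|} ≤ 3`).
* §2 **`jt_mul_prod_jt_rpow_le`** (`j̃(l_μ)·Π_i j̃(l_i)^{1∕D} ≤ (64∕7)·‖Δ^ξ(k+2πl)‖`, `l ≠ 0`: every `j̃_i ≤ √B`), **`jt_mul_norm_ew_mul_prod_le`**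
  (`≤ (1024∕7)·D`, the SAME constant as gen-8's `norm_ew_mul_prod_le`), `jt_mul_norm_q_mul_ew_le`, **`sum_jt_mul_norm_q_mul_ew_le`** (`≤ Cqe D`, both `qa` and `qb`).
Unit `b2b-balaban-beta-d1-formalise-leaf-06` (gen 9), road «FP» OWNER GO R-FP-35 (e) journal l.27818 on INTENT l.27787 (offer O1 of l.27658); organisation γ (R-FP-25), row GAMMA-3 (in flight), under R-FP-33 (b)(c).
-/

noncomputable section

namespace Summit.QuantumFields.BalabanUV.Beta.FP.SliceProjectorDiffChord

open Complex Finset MeasureTheory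
open scoped BigOperators Real
open Literature.MathematicalPhysics.QuantumFieldTheory.Balaban1983to89
open Literature.MathematicalPhysics.QuantumFieldTheory.Balaban1983to89.Beta.AffineAveraging (unitVec unitVec_apply)
open B4Strip (Strip ofRealVec DeltaXi shift U)
open B4StripCauchy (Fat rOf rOf_le rOf_pos strip_subset_fat norm_DeltaXi_le norm_DeltaXi_shift_ge d_mul_rOf_sq_le)
open B5Strip145 (Ncal)
open B4ContourShift (BZ phase integrand fourierBox latticeKernel StripRegular supNorm latticeKernel_decay ofRealVec_mem_Strip)
open B4Green244 (latticeKernel_congr)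
open Beta.FibreInverseDecay (cphase)
open Summit.QuantumFields.BalabanUV.Beta.GAN24.FibreSymbols (gsum pw pw_add pw_add_unitVec pw_sub_unitVec)
open Summit.QuantumFields.BalabanUV.Beta.GAN24.AliasDecimate (aliasPt)
open Summit.QuantumFields.BalabanUV.Beta.GAN24.AliasStripSymbols (norm_cexp_I_mul_sub_one_le')
open Summit.QuantumFields.BalabanUV.Beta.FP.CoarseCovarianceStripAliasWeights (aliasPt_apply' aliasPt_im)
open Summit.QuantumFields.BalabanUV.Beta.FP.SliceProjectorMidInv (kapY kapY_pos kapY_le_rOf Ncal_lower)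
open Summit.QuantumFields.BalabanUV.Beta.FP.SliceProjectorEntries (qa qb ew Aent ew_zero ew_ne qa_mul_qb strip_facts)
open Summit.QuantumFields.BalabanUV.Beta.FP.SliceProjectorSymbol (S)
open Summit.QuantumFields.BalabanUV.Beta.FP.SliceProjectorAliasIndex (jt one_le_jt jt_pos jt_of_val_zero jt_eq_or c1 c1_pos fat_facts
  aliasPt_re_half aliasPt_im_mul norm_qa_le_prod norm_qb_le_prod)
open Summit.QuantumFields.BalabanUV.Beta.FP.SliceProjectorAliasSum (jt_sq_le_norm_DeltaXi_shift eD eD_pos eD_le_one eD_mul prod_jt_rpow_le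
  wt wt_nonneg prod_wt_eq Cqe Cqe_nonneg sum_wt_le sum_prod_wt_eq sum_norm_qa_mul_ew_le sum_norm_qb_mul_ew_le l1 l1_neg norm_cphase_le
  cN cN_pos MS CS exp_offset_le norm_Aent_eq stripRegular_S MS_le_CS)
open Summit.QuantumFields.BalabanUV.Beta.FP.SliceProjectorBlochChart
open Summit.QuantumFields.BalabanUV.Beta.FP.SliceProjectorBloch
open Summit.QuantumFields.BalabanUV.Beta.FP.SliceProjectorKernel
open Summit.QuantumFields.BalabanUV.Beta.FP.SliceProjectorKernelLaplace (cphase_add_unitVec cphase_sub_unitVec)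

variable {d : ℕ}

/-! ## §1 The chord at an alias momentum: `‖e^{±i k_{l,μ}} − 1‖ ≤ 33·j̃(l_μ)∕N` (distance to the NEAREST alias) -/

/-- [folklore] `e^{iw}` only sees `Re w` modulo `2π`: `‖e^{iw} − 1‖ ≤ (|Re w − 2πm| + |Im w|)·e^{|Im w|}` for every integer `m`. -/
theorem norm_cexp_I_mul_sub_one_le_shift (w : ℂ) (m : ℤ) :
    ‖cexp (I * w) - 1‖ ≤ (|w.re - 2 * π * m| + |w.im|) * Real.exp |w.im| := by
  have hper : cexp (I * w) = cexp (I * (w - 2 * π * m)) := by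
    rw [mul_sub, Complex.exp_sub, show I * (2 * π * (m : ℂ)) = (m : ℂ) * (2 * π * I) by ring, Complex.exp_int_mul_two_pi_mul_I, div_one]
  rw [hper]
  have h := norm_cexp_I_mul_sub_one_le' (w - 2 * π * m)
  have hre : (w - 2 * π * (m : ℂ)).re = w.re - 2 * π * m := by simp
  have him : (w - 2 * π * (m : ℂ)).im = w.im := by simp
  rwa [hre, him] at h

/-- [folklore] the real part of an alias momentum: `Re (k_l)_i = (Re p_i + 2πl_i)∕n`. -/
theorem aliasPt_re (n : ℕ) [NeZero n] (l : Fin (d + 1) → Fin n) (p : Fin (d + 1) → ℂ) (i : Fin (d + 1)) :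
    (aliasPt n l p i).re = ((p i).re + 2 * Real.pi * ((l i : ℕ) : ℝ)) / n := by
  have h := aliasPt_re_half n l p i
  have hn : (n : ℝ) ≠ 0 := Nat.cast_ne_zero.mpr (NeZero.ne n)
  field_simp at h
  field_simp
  linarith

/-- [folklore] **THE CHORD BOUND AT AN ALIAS MOMENTUM** on the fat strip: `‖e^{i(k_l)_μ} − 1‖ ≤ 33·j̃(l_μ)∕n` — the alias momentum is
within `10·j̃∕n` of `2πℤ` in real part and within `1∕n` in imaginary part. -/
theorem norm_cexp_aliasPt_sub_one_le (n : ℕ) [NeZero n] {p : Fin (d + 1) → ℂ} (hp : p ∈ Fat (d + 1) (rOf (d + 1)))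
    (l : Fin (d + 1) → Fin n) (μ : Fin (d + 1)) (s : ℤ) (hs : s = 1 ∨ s = -1) :
    ‖cexp (I * ((s : ℂ) * aliasPt n l p μ)) - 1‖ ≤ 33 * jt n (l μ) / n := by
  have hn0 : (0 : ℝ) < n := by exact_mod_cast Nat.pos_of_ne_zero (NeZero.ne n)
  have hπ := Real.pi_lt_d2
  have hπ3 := Real.pi_gt_three
  have hr := rOf_le (d + 1)
  have hx : |(p μ).re| ≤ Real.pi + rOf (d + 1) := (fat_facts hp μ).1
  have himn : |(aliasPt n l p μ).im| * n ≤ 1 := aliasPt_im_mul n hp l μ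
  have him1 : |(aliasPt n l p μ).im| ≤ 1 / n := by rw [le_div_iff₀ hn0]; exact himn
  have hjt1 := one_le_jt (l μ)
  have hj0 : (0 : ℝ) ≤ ((l μ : ℕ) : ℝ) := Nat.cast_nonneg _
  have hjn : ((l μ : ℕ) : ℝ) + 1 ≤ n := by exact_mod_cast (l μ).isLt
  -- the nearest alias: m = 0 if j̃ = j+1, m = 1 if j̃ = n−j
  set t : ℝ := jt n (l μ) / n with ht
  have ht1 : 1 / (n : ℝ) ≤ t := div_le_div_of_nonneg_right hjt1 hn0.le
  obtain ⟨m, hm⟩ : ∃ m : ℤ, |(aliasPt n l p μ).re - 2 * π * m| ≤ 10 * t := by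
    rcases jt_eq_or (l μ) with h | h
    · refine ⟨0, ?_⟩
      rw [Int.cast_zero, mul_zero, sub_zero, aliasPt_re, abs_div, Nat.abs_cast, ht, ← mul_div_assoc, div_le_div_iff_of_pos_right hn0, h]
      have h2 : (0 : ℝ) ≤ 2 * Real.pi * ((l μ : ℕ) : ℝ) := by positivity
      calc |(p μ).re + 2 * Real.pi * ((l μ : ℕ) : ℝ)| ≤ |(p μ).re| + |2 * Real.pi * ((l μ : ℕ) : ℝ)| := abs_add_le _ _
        _ = |(p μ).re| + 2 * Real.pi * ((l μ : ℕ) : ℝ) := by rw [abs_of_nonneg h2]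
        _ ≤ 10 * (((l μ : ℕ) : ℝ) + 1) := by nlinarith [abs_nonneg ((p μ).re)]
    · refine ⟨1, ?_⟩
      rw [Int.cast_one, mul_one, aliasPt_re, ht, h]
      have hn : (n : ℝ) ≠ 0 := hn0.ne'
      rw [show ((p μ).re + 2 * Real.pi * ((l μ : ℕ) : ℝ)) / n - 2 * π = ((p μ).re - 2 * Real.pi * ((n : ℝ) - (l μ : ℕ))) / n by
        field_simp; ring, abs_div, Nat.abs_cast, ← mul_div_assoc, div_le_div_iff_of_pos_right hn0]
      have hnj : (0 : ℝ) ≤ 2 * Real.pi * ((n : ℝ) - (l μ : ℕ)) := by nlinarith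
      calc |(p μ).re - 2 * Real.pi * ((n : ℝ) - (l μ : ℕ))| ≤ |(p μ).re| + |2 * Real.pi * ((n : ℝ) - (l μ : ℕ))| := abs_sub _ _
        _ = |(p μ).re| + 2 * Real.pi * ((n : ℝ) - (l μ : ℕ)) := by rw [abs_of_nonneg hnj]
        _ ≤ 10 * ((n : ℝ) - (l μ : ℕ)) := by nlinarith [abs_nonneg ((p μ).re)]
  -- apply the shifted chord bound to `w = s·q` with the shift `s·m`
  have key : ‖cexp (I * ((s : ℂ) * aliasPt n l p μ)) - 1‖
      ≤ (|(aliasPt n l p μ).re - 2 * π * m| + |(aliasPt n l p μ).im|) * Real.exp |(aliasPt n l p μ).im| := by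
    have h := norm_cexp_I_mul_sub_one_le_shift ((s : ℂ) * aliasPt n l p μ) (s * m)
    rcases hs with hs1 | hs1 <;> subst hs1
    · simpa using h
    · refine h.trans (le_of_eq ?_)
      simp only [Int.cast_neg, Int.cast_one, neg_mul, one_mul, Complex.neg_re, Complex.neg_im, abs_neg, mul_neg]
      rw [show -(aliasPt n l p μ).re - -(2 * π * (m : ℝ)) = -((aliasPt n l p μ).re - 2 * π * m) by ring, abs_neg]
  refine key.trans ?_
  have hexp : Real.exp |(aliasPt n l p μ).im| ≤ 3 := by
    have h1 : |(aliasPt n l p μ).im| ≤ 1 := him1.trans (by rw [div_le_one hn0]; exact_mod_cast Nat.one_le_iff_ne_zero.mpr (NeZero.ne n))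
    have := Real.exp_le_exp.mpr h1
    have e1 := Real.exp_one_lt_d9
    linarith
  have hsum : |(aliasPt n l p μ).re - 2 * π * m| + |(aliasPt n l p μ).im| ≤ 11 * t := by linarith
  have ht0 : 0 ≤ t := by positivity
  calc (|(aliasPt n l p μ).re - 2 * π * ↑m| + |(aliasPt n l p μ).im|) * Real.exp |(aliasPt n l p μ).im|
      ≤ (11 * t) * 3 := mul_le_mul hsum hexp (Real.exp_pos _).le (by positivity)
    _ = 33 * jt n (l μ) / n := by rw [ht]; ring

/-! ## §2 The extra residue weight costs nothing: `j̃(l_μ)·‖e_l‖·Π_i j̃_i^{1∕D} ≤ (1024∕7)·D` -/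

/-- [folklore] **`j̃(l_μ)·Π_i j̃(l_i)^{1∕D} ≤ (64∕7)·‖Δ^ξ(p+2πl)‖`** for `l ≠ 0` (every `j̃_i² ≤ B` ⟹ `Π j̃_i^{1∕D} ≤ √B` and `j̃_μ ≤ √B`). -/
theorem jt_mul_prod_jt_rpow_le (n : ℕ) [NeZero n] {p : Fin (d + 1) → ℂ} (hp : p ∈ Fat (d + 1) (rOf (d + 1)))
    (l : Fin (d + 1) → Fin n) (hl : l ≠ fun _ => 0) (μ : Fin (d + 1)) :
    jt n (l μ) * ∏ i, jt n (l i) ^ eD d ≤ 64 / 7 * ‖DeltaXi n 0 (shift n l p)‖ := by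
  set B := 64 / 7 * ‖DeltaXi n 0 (shift n l p)‖ with hB
  have hB0 : 0 ≤ B := by positivity
  have hsq : ∀ i, jt n (l i) ^ 2 ≤ B := fun i => jt_sq_le_norm_DeltaXi_shift n hp l hl i
  have hle : ∀ i, jt n (l i) ≤ Real.sqrt B := fun i => Real.le_sqrt_of_sq_le (hsq i)
  have h1 : ∏ i, jt n (l i) ^ eD d ≤ Real.sqrt B := by
    calc ∏ i, jt n (l i) ^ eD d ≤ ∏ _i : Fin (d + 1), Real.sqrt B ^ eD d :=
          Finset.prod_le_prod (fun i _ => Real.rpow_nonneg (jt_pos _).le _)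
            fun i _ => Real.rpow_le_rpow (jt_pos _).le (hle i) (eD_pos d).le
      _ = Real.sqrt B := by
          rw [Finset.prod_const, Finset.card_univ, Fintype.card_fin, ← Real.rpow_natCast, ← Real.rpow_mul (Real.sqrt_nonneg _)]
          push_cast
          rw [eD_mul, Real.rpow_one]
  calc jt n (l μ) * ∏ i, jt n (l i) ^ eD d ≤ Real.sqrt B * Real.sqrt B :=
        mul_le_mul (hle μ) h1 (Finset.prod_nonneg fun i _ => Real.rpow_nonneg (jt_pos _).le _) (Real.sqrt_nonneg _)
    _ = B := Real.mul_self_sqrt hB0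

/-- [folklore] **`j̃(l_μ)·‖e_l‖·Π_i j̃(l_i)^{1∕D} ≤ (1024∕7)·D`** on the fat strip, every `l` — the SAME constant as gen-8's `norm_ew_mul_prod_le`. -/
theorem jt_mul_norm_ew_mul_prod_le (n : ℕ) [NeZero n] {p : Fin (d + 1) → ℂ} (hp : p ∈ Fat (d + 1) (rOf (d + 1)))
    (l : Fin (d + 1) → Fin n) (μ : Fin (d + 1)) : jt n (l μ) * ‖ew n l p‖ * ∏ i, jt n (l i) ^ eD d ≤ 1024 / 7 * ((d : ℝ) + 1) := by
  have hn1 : 1 ≤ n := Nat.one_le_iff_ne_zero.mpr (NeZero.ne n)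
  have hd : (0 : ℝ) ≤ d := Nat.cast_nonneg d
  by_cases hl : l = fun _ => 0
  · subst hl
    rw [ew_zero, norm_one, mul_one, jt_of_val_zero (Fin.val_zero n), one_mul]
    have h1 : ∀ i : Fin (d + 1), jt n ((fun _ : Fin (d + 1) => (0 : Fin n)) i) ^ eD d = 1 := fun i => by
      rw [jt_of_val_zero (Fin.val_zero n), Real.one_rpow]
    rw [Finset.prod_congr rfl fun i _ => h1 i, Finset.prod_const_one]
    linarith
  · have h16 : ‖DeltaXi n 0 p‖ ≤ 16 * ((d : ℝ) + 1) := by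
      have h := norm_DeltaXi_le n hn1 0 le_rfl (rOf_le (d + 1)) hp
      push_cast at h; linarith
    have h2 : 2 ≤ ‖DeltaXi n 0 (shift n l p)‖ :=
      norm_DeltaXi_shift_ge n 0 le_rfl (rOf_le (d + 1)) (by exact_mod_cast d_mul_rOf_sq_le (d + 1)) hp l hl
    have hne : ‖DeltaXi n 0 (shift n l p)‖ ≠ 0 := by linarith
    have hprod := jt_mul_prod_jt_rpow_le n hp l hl μ
    rw [ew_ne n hl, norm_div]
    calc jt n (l μ) * (‖DeltaXi n 0 p‖ / ‖DeltaXi n 0 (shift n l p)‖) * ∏ i, jt n (l i) ^ eD d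
        = ‖DeltaXi n 0 p‖ / ‖DeltaXi n 0 (shift n l p)‖ * (jt n (l μ) * ∏ i, jt n (l i) ^ eD d) := by ring
      _ ≤ ‖DeltaXi n 0 p‖ / ‖DeltaXi n 0 (shift n l p)‖ * (64 / 7 * ‖DeltaXi n 0 (shift n l p)‖) :=
          mul_le_mul_of_nonneg_left hprod (by positivity)
      _ = 64 / 7 * ‖DeltaXi n 0 p‖ := by field_simp
      _ ≤ 1024 / 7 * ((d : ℝ) + 1) := by linarith

/-- [folklore] the weighted product majorants: `j̃(l_μ)·‖qa_l‖·‖e_l‖ ≤ (1024∕7)·D·Π_i wt(l_i)` and the same for `qb`. -/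
theorem jt_mul_norm_q_mul_ew_le (n : ℕ) [NeZero n] {p : Fin (d + 1) → ℂ} (hp : p ∈ Fat (d + 1) (rOf (d + 1)))
    (l : Fin (d + 1) → Fin n) (μ : Fin (d + 1)) :
    jt n (l μ) * (‖qa n l p‖ * ‖ew n l p‖) ≤ 1024 / 7 * ((d : ℝ) + 1) * ∏ i, wt d n (l i) ∧
      jt n (l μ) * (‖qb n l p‖ * ‖ew n l p‖) ≤ 1024 / 7 * ((d : ℝ) + 1) * ∏ i, wt d n (l i) := by
  have hP0 : 0 < ∏ i, jt n (l i) ^ eD d := Finset.prod_pos fun i _ => Real.rpow_pos_of_pos (jt_pos _) _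
  have hK : jt n (l μ) * ‖ew n l p‖ ≤ 1024 / 7 * ((d : ℝ) + 1) * (∏ i, jt n (l i) ^ eD d)⁻¹ := by
    rw [← div_eq_mul_inv, le_div_iff₀ hP0]; exact jt_mul_norm_ew_mul_prod_le n hp l μ
  have hc : 0 ≤ ∏ i, c1 / jt n (l i) := Finset.prod_nonneg fun i _ => div_nonneg c1_pos.le (jt_pos _).le
  have hj0 := (jt_pos (l μ)).le
  rw [prod_wt_eq]
  constructor
  · calc jt n (l μ) * (‖qa n l p‖ * ‖ew n l p‖) = ‖qa n l p‖ * (jt n (l μ) * ‖ew n l p‖) := by ring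
      _ ≤ (∏ i, c1 / jt n (l i)) * (1024 / 7 * ((d : ℝ) + 1) * (∏ i, jt n (l i) ^ eD d)⁻¹) :=
          mul_le_mul (norm_qa_le_prod n hp l) hK (by positivity) hc
      _ = _ := by ring
  · calc jt n (l μ) * (‖qb n l p‖ * ‖ew n l p‖) = ‖qb n l p‖ * (jt n (l μ) * ‖ew n l p‖) := by ring
      _ ≤ (∏ i, c1 / jt n (l i)) * (1024 / 7 * ((d : ℝ) + 1) * (∏ i, jt n (l i) ^ eD d)⁻¹) :=
          mul_le_mul (norm_qb_le_prod n hp l) hK (by positivity) hc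
      _ = _ := by ring

/-- [our object] **THE WEIGHTED ALIAS SUMS ARE n-UNIFORM WITH THE SAME CONSTANT**: `Σ_l j̃(l_μ)·‖qa_l‖‖e_l‖ ≤ Cqe D` and the same for `qb`. -/
theorem sum_jt_mul_norm_q_mul_ew_le (n : ℕ) [NeZero n] {p : Fin (d + 1) → ℂ} (hp : p ∈ Fat (d + 1) (rOf (d + 1))) (μ : Fin (d + 1)) :
    ∑ l : Fin (d + 1) → Fin n, jt n (l μ) * (‖qa n l p‖ * ‖ew n l p‖) ≤ Cqe d ∧
      ∑ l : Fin (d + 1) → Fin n, jt n (l μ) * (‖qb n l p‖ * ‖ew n l p‖) ≤ Cqe d := by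
  have hw0 : 0 ≤ ∑ j : Fin n, wt d n j := Finset.sum_nonneg fun j _ => wt_nonneg d n j
  have hd : (0 : ℝ) ≤ d := Nat.cast_nonneg d
  have hend : ∑ l : Fin (d + 1) → Fin n, 1024 / 7 * ((d : ℝ) + 1) * ∏ i, wt d n (l i) ≤ Cqe d := by
    rw [← Finset.mul_sum, sum_prod_wt_eq]
    unfold Cqe
    exact mul_le_mul_of_nonneg_left (pow_le_pow_left₀ hw0 (sum_wt_le d n) _) (by positivity)
  exact ⟨(Finset.sum_le_sum fun l _ => (jt_mul_norm_q_mul_ew_le n hp l μ).1).trans hend,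
    (Finset.sum_le_sum fun l _ => (jt_mul_norm_q_mul_ew_le n hp l μ).2).trans hend⟩

end Summit.QuantumFields.BalabanUV.Beta.FP.SliceProjectorDiffChord

end
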